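import Literature.NumberTheory.Sieve.BombieriFriedlanderIwaniecTheorem9CaseI
import Literature.NumberTheory.Sieve.BombieriFriedlanderIwaniecTheorem9CaseII
import HarnessLib

/-!
# Bombieri–Friedlander–Iwaniec 1986, §16 for Theorem 9: the interior box-tuples

Topic `Literature/NumberTheory/Sieve`, sibling of
`Literature.NumberTheory.Sieve.BombieriFriedlanderIwaniecTheorem9Proofs`; the analogue for Theorem 9
of `Literature.NumberTheory.Sieve.BombieriFriedlanderIwaniecInterior` (§17 for Theorem 10).
Everything here is PROVED (the named facts Theorems 6, 7*, Lemma 3 of BFI 1986 and Shiu 1980, the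
Siegel–Walfisz theorem for `μ` and the fundamental lemma enter as hypotheses); no named fact is
introduced.

* `BFI.genuine_pieces_bound9` — an interior family of genuine pieces of a sieved Heath-Brown piece,
  against the pair sum of Theorem 9 (`γ_q = 1_{q ≤ Q,(q,a)=1}`, `δ_r 1_{r ≤ R,(r,a)=1}`,
  `R < x^{1/10−ε}`, `QR < xℒ^{−B}`): the dichotomy of §16 (p. 250) on the exponents — (16.1) a
  partial sum in `[max(θ+2e, 2/15), (1−θ)/3 − 2e]`, **Theorem 6** (`BFI.caseI_bound`, with
  `BFI.sparse_bound_pairs` for sparse pieces and (A₂) by `BFI.siegelWalfiszHyp_prod_pieces`), or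
  (16.2) at most three large box indicators, **Theorem 7*** (`BFI.caseII_bound`,
  `BFI.caseII_corners`, ranges by `BFI.range_theorem7Star_of_two_le`);
* `BFI.interior_tuple_bound9` — from an interior box-tuple `κ` to its genuine pieces (the factors with
  box below `1` are Dirichlet units), verbatim as `BFI.interior_tuple_bound`.

## References

* E. Bombieri, J. B. Friedlander, H. Iwaniec, *Primes in arithmetic progressions to large moduli*,
  Acta Math. 156 (1986), 203–251: §1 Theorem 9 p. 209; §2 Lemma 3 p. 211; §14 pp. 244–246;
  §15 pp. 244–246; §16 p. 250. [BombieriFriedlanderIwaniecActa1986]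
* P. Shiu, *A Brun–Titchmarsh theorem for multiplicative functions*, J. reine angew. Math. 313
  (1980), 161–170, Theorem 1. [Shiu1980]
-/

open Finset Real
open scoped ArithmeticFunction.sigma ArithmeticFunction.zeta ArithmeticFunction.Moebius

namespace Literature.NumberTheory.Sieve

namespace BFI

/-! ### Small tools for the dispatch -/

/-- The sieved box indicator as `1_{(Y₁,Y₂]} · 1_rough`. [folklore] -/
theorem roughBoxOne_eq_ite_Ioc (z : ℝ) (Y₁ Y₂ m : ℕ) :
    roughBoxOne z Y₁ Y₂ m = if m ∈ Ioc Y₁ Y₂ then roughIndicator z m else 0 := by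
  unfold roughBoxOne
  by_cases hm : m ∈ Ioc Y₁ Y₂
  · rw [if_pos hm]
    have hm' := Finset.mem_Ioc.1 hm
    have hm0 : m ≠ 0 := by omega
    rw [roughIndicator_eq_ite]
    by_cases hr : IsRough z m
    · have hc : m.Coprime (primesProdBelow z) := (isRough_iff_coprime_primesProdBelow hm0).1 hr
      rw [if_pos ⟨hm'.1, hm'.2, hc⟩, if_pos hr]
    · have hc : ¬ m.Coprime (primesProdBelow z) := fun h =>
        hr ((isRough_iff_coprime_primesProdBelow hm0).2 h)
      rw [if_neg (fun h => hc h.2.2), if_neg hr]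
  · rw [if_neg hm, if_neg]
    intro h
    exact hm (Finset.mem_Ioc.2 ⟨h.1, h.2.1⟩)

/-- The Dirichlet unit as the trivial `n`-piece: `1 = 1_{(0,1]} · 1_rough`. [folklore] -/
theorem one_apply_eq_ite_Ioc (z : ℝ) (n : ℕ) :
    (1 : ArithmeticFunction ℝ) n = if n ∈ Ioc ⌊(0 : ℝ)⌋₊ ⌊(1 : ℝ)⌋₊ then roughIndicator z n else 0 := by
  rw [Nat.floor_zero, Nat.floor_one, ArithmeticFunction.one_apply]
  by_cases hn : n = 1
  · subst hn; simp [roughIndicator_one]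
  · rw [if_neg hn, if_neg]
    intro h; rw [Finset.mem_Ioc] at h; omega

/-- The exponent bookkeeping of Case II: with `η = L^{−(A₅+B_t+1)}`, `W = C_c x L^{−(2A₅+B_t+1)}`,
`(η/2)·(C_t x L^{B_t}) + (2η)⁻¹·4W ≤ (C_t/2 + 2C_c) x L^{−A₅}` for `L ≥ 1`. [folklore] -/
theorem caseII_eta_algebra {L x A₅ Bt Ct Cc : ℝ} (hL : 1 ≤ L) (hx : 0 ≤ x) (hCt : 0 ≤ Ct) :
    L ^ (-(A₅ + Bt + 1)) / 2 * (Ct * x * L ^ Bt) +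
        (L ^ (-(A₅ + Bt + 1)))⁻¹ / 2 * (4 * (Cc * x / L ^ (2 * A₅ + Bt + 1))) ≤
      (Ct / 2 + 2 * Cc) * x / L ^ A₅ := by
  have hL0 : 0 < L := by linarith
  have h1 : L ^ (-(A₅ + Bt + 1)) * L ^ Bt = L ^ (-(A₅ + 1)) := by
    rw [← Real.rpow_add hL0]; ring_nf
  have h2 : (L ^ (-(A₅ + Bt + 1)))⁻¹ / L ^ (2 * A₅ + Bt + 1) = (L ^ A₅)⁻¹ := by
    rw [Real.rpow_neg hL0.le, inv_inv, div_eq_mul_inv, ← Real.rpow_neg hL0.le, ← Real.rpow_add hL0,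
      ← Real.rpow_neg hL0.le]
    ring_nf
  have h3 : L ^ (-(A₅ + 1)) ≤ (L ^ A₅)⁻¹ := by
    rw [← Real.rpow_neg hL0.le]
    exact Real.rpow_le_rpow_of_exponent_le hL (by linarith)
  have hA0 : 0 < L ^ A₅ := Real.rpow_pos_of_pos hL0 _
  calc L ^ (-(A₅ + Bt + 1)) / 2 * (Ct * x * L ^ Bt) +
        (L ^ (-(A₅ + Bt + 1)))⁻¹ / 2 * (4 * (Cc * x / L ^ (2 * A₅ + Bt + 1)))
      = Ct / 2 * x * (L ^ (-(A₅ + Bt + 1)) * L ^ Bt) +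
          2 * Cc * x * ((L ^ (-(A₅ + Bt + 1)))⁻¹ / L ^ (2 * A₅ + Bt + 1)) := by ring
    _ = Ct / 2 * x * L ^ (-(A₅ + 1)) + 2 * Cc * x * (L ^ A₅)⁻¹ := by rw [h1, h2]
    _ ≤ Ct / 2 * x * (L ^ A₅)⁻¹ + 2 * Cc * x * (L ^ A₅)⁻¹ := by
        refine add_le_add (mul_le_mul_of_nonneg_left h3 (by positivity)) le_rfl
    _ = (Ct / 2 + 2 * Cc) * x / L ^ A₅ := by ring

/-! ### The bound for a family of genuine pieces (BFI §16) -/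

set_option maxHeartbeats 3200000 in -- the dispatch of §16 with ~150 hypotheses in play
/-- **The interior pieces, grouped and dispatched along BFI §16 (p. 250).**  Let `f i` (`i ∈ G`,
`#G ≤ 14`) be nonzero pieces bounded by `1`, supported in the boxes `(P_i, (1+Δ)P_i]` (`P_i ≥ 1`) on
`z`-rough integers, `z = exp(√log x)`, each either a sieved box indicator (`roughBoxOne`) or a sieved,
boxed Möbius function with `P_i < U ≤ 4x^{1/7}` (`roughBoxMoebius`); let `X' = ∏ P_i ∈ [x, 2^{15}x]`
with `(1+Δ)^{#G} X' ≤ 2x`, `(1+Δ)^{14} ≤ 2`, `Δ ≤ 1/2`; and let the moduli be the pairs `qr`,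
`q ≤ Q`, `r ≤ R` (`Q, R ≥ 1`, `R < x^{1/10−ε}`, `QR < xℒ^{−B}`) with weights `1_{(q,a)=1}` and
`δ_r 1_{(r,a)=1}`, `|δ| ≤ 1`.  With `θ = log R / log X'` (`< 1/10 − ε`) and the exponents
`e_i = log P_i / log X'` (summing to `1`), the dichotomy `BFI.exists_subsum_mem_Icc_or`
(`a = max(θ + 2e, 2/15)`, `b = (1−θ)/3 − 2e`, `e = ε/10`; `2a ≤ b` as `θ < 1/10`) gives EITHER a partial
product `N = X'^t`, `a ≤ t ≤ b` — (16.1): `BFI.sparse_bound_pairs`, or (A₂) by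
`siegelWalfiszHyp_prod_pieces` and **Theorem 6** through `BFI.caseI_bound` — OR at most three
pieces of exponent `> b` (all box indicators, the Möbius pieces having exponent `< 1/7 + o(1)`) and the
others of total `< a` — (16.2): the largest such piece is `m`, a second one (if any) is `n`, the rest
is `l`, and **Theorem 7*** applies through `BFI.caseII_bound` / `BFI.caseII_corners`
(`BFI.range_theorem7Star_of_two_le`).  Conclusion:
`|∑_{r ≤ R,(r,a)=1} δ_r ∑_{q ≤ Q,(q,a)=1} sievedDisc (∏_G f) (qr) a z x| ≤ C x (log x)^{−A₅}` for
`x ≥ x₀`, `QR < xℒ^{−B}` (`B` returned: the level exponent inherited from Theorems 6 and 7*).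
[cite: BombieriFriedlanderIwaniecActa1986, §16 (16.1)–(16.2) p. 250] -/
theorem genuine_pieces_bound9
    (h6 : BombieriFriedlanderIwaniecTheorem6) (h7 : BombieriFriedlanderIwaniecTheorem7Star)
    (hL3 : BombieriFriedlanderIwaniecLemma3) (hShiu : Shiu1980BrunTitchmarsh)
    (hSWμ : LFunctions.SiegelWalfiszMoebius) (hFL : SieveSequence.fundamental_lemma_uniform)
    {a : ℤ} (ha : a ≠ 0) {ε : ℝ} (hε : 0 < ε) (hε' : ε ≤ 1 / 100) {A₅ : ℝ} (hA₅ : 0 ≤ A₅) :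
    ∃ B C x₀ : ℝ, 0 ≤ B ∧ 0 ≤ C ∧ ∀ x : ℝ, x₀ ≤ x →
      ∀ {ι : Type} [Fintype ι] [DecidableEq ι] (G : Finset ι) (f : ι → ArithmeticFunction ℝ)
        (P : ι → ℝ) (Δ : ℝ) (U : ℕ) (Q R : ℝ) (δ : ℕ → ℝ),
      (∀ r, |δ r| ≤ 1) → 1 ≤ Q → 1 ≤ R → R < x ^ (1 / 10 - ε) → Q * R < x / Real.log x ^ B →
      0 < Δ → Δ ≤ 1 / 2 → (1 + Δ) ^ 14 ≤ 2 → G.card ≤ 14 → (U : ℝ) ≤ 4 * x ^ (1 / 7 : ℝ) →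
      (∀ i ∈ G, 1 ≤ P i) → (∀ i ∈ G, ∀ n, |f i n| ≤ 1) →
      (∀ i ∈ G, ∀ n : ℕ, f i n ≠ 0 →
        P i < n ∧ (n : ℝ) ≤ (1 + Δ) * P i ∧ IsRough (Real.exp (Real.sqrt (Real.log x))) n) →
      (∀ i ∈ G, f i ≠ 0) →
      (∀ i ∈ G,
        (⇑(f i) = roughBoxOne (Real.exp (Real.sqrt (Real.log x))) ⌊P i⌋₊ ⌊(1 + Δ) * P i⌋₊ ∧
          ∀ n : ℕ, n ≠ 0 → f i n = if P i < n ∧ (n : ℝ) ≤ (1 + Δ) * P i then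
            (if IsRough (Real.exp (Real.sqrt (Real.log x))) n then 1 else 0) else 0) ∨
        (P i < U ∧ ⇑(f i) = roughBoxMoebius (Real.exp (Real.sqrt (Real.log x))) ⌊P i⌋₊
          (min ⌊(1 + Δ) * P i⌋₊ U))) →
      x ≤ ∏ i ∈ G, P i → (∏ i ∈ G, P i) ≤ 2 ^ 15 * x →
      (1 + Δ) ^ G.card * ∏ i ∈ G, P i ≤ 2 * x →
      |∑ r ∈ (Icc 1 ⌊R⌋₊).filter (fun r : ℕ => IsCoprime (r : ℤ) a),
          δ r * ∑ q ∈ (Icc 1 ⌊Q⌋₊).filter (fun q : ℕ => IsCoprime (q : ℤ) a),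
            sievedDisc (fun n => (∏ i ∈ G, f i) n) (q * r) a (Real.exp (Real.sqrt (Real.log x))) x| ≤
        C * x / Real.log x ^ A₅ := by
  -- the slack `e = ε/10`
  set e : ℝ := ε / 10 with hedef
  have he : 0 < e := by positivity
  have he15 : e ≤ 1 / 15 := by rw [hedef]; linarith only [hε']
  have he1 : e ≤ 1 := by linarith only [he15]
  have h5e : 5 * e ≤ ε := by rw [hedef]; linarith only [hε]
  -- constants
  obtain ⟨cD, Cs, xs, hcD, hCs, hsp⟩ := sparse_bound_pairs hL3 ha hA₅
  have hOne : ∀ A₁ A₂ : ℝ, ∃ C : ℝ, 0 < A₁ → 0 < A₂ → (0 < C ∧ ∀ (z Nh : ℝ) (Y₁ Y₂ : ℕ),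
      2 ≤ z → z ≤ Real.sqrt Nh → Real.log z ≤ 12 * Real.sqrt (Real.log Nh) → 3 ≤ Nh → Nh ≤ Y₁ →
      (Y₂ : ℝ) ≤ 2 * Nh → SWAbs (roughBoxOne z Y₁ Y₂) Nh A₁ A₂ C) := by
    intro A₁ A₂
    by_cases hA : 0 < A₁ ∧ 0 < A₂
    · obtain ⟨C, hC, h⟩ := swabs_roughBoxOne hFL (K := 12) (by norm_num) hA.1 hA.2
      exact ⟨C, fun _ _ => ⟨hC, h⟩⟩
    · exact ⟨1, fun h1' h2' => absurd ⟨h1', h2'⟩ hA⟩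
  choose Cone hCone using hOne
  have hMo : ∀ A₁ A₂ : ℝ, ∃ C : ℝ, 0 < A₁ → 0 < A₂ → (0 < C ∧ ∀ (z Nh : ℝ) (Y₁ Y₂ : ℕ),
      8 ≤ z → Real.log z ≤ 12 * Real.sqrt (Real.log Nh) → Real.exp 16 ≤ Nh → Nh ≤ Y₁ → Y₁ ≤ Y₂ →
      (Y₂ : ℝ) ≤ 2 * Nh → SWAbs (roughBoxMoebius z Y₁ Y₂) Nh A₁ A₂ C) := by
    intro A₁ A₂
    by_cases hA : 0 < A₁ ∧ 0 < A₂
    · obtain ⟨C, hC, h⟩ := swabs_roughBoxMoebius hSWμ (K := 12) (by norm_num) hA.1 hA.2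
      exact ⟨C, fun _ _ => ⟨hC, h⟩⟩
    · exact ⟨1, fun h1' h2' => absurd ⟨h1', h2'⟩ hA⟩
  choose Cmo hCmo using hMo
  set Ch : ℝ → ℝ → ℝ := fun A₁ A₂ => max (Cone A₁ A₂) (Cmo A₁ A₂) with hChdef
  have hCh1 : ∀ A₁ A₂ : ℝ, 0 < A₁ → 0 < A₂ → ∀ (z Nh : ℝ) (Y₁ Y₂ : ℕ), 2 ≤ z → z ≤ Real.sqrt Nh →
      Real.log z ≤ 12 * Real.sqrt (Real.log Nh) → 3 ≤ Nh → Nh ≤ Y₁ → (Y₂ : ℝ) ≤ 2 * Nh →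
      SWAbs (roughBoxOne z Y₁ Y₂) Nh A₁ A₂ (Ch A₁ A₂) :=
    fun A₁ A₂ hA₁ hA₂ z Nh Y₁ Y₂ hz hzN hlz hN3 hY1 hY2 =>
      ((hCone A₁ A₂ hA₁ hA₂).2 z Nh Y₁ Y₂ hz hzN hlz hN3 hY1 hY2).mono (le_max_left _ _) (by linarith)
  have hCh2 : ∀ A₁ A₂ : ℝ, 0 < A₁ → 0 < A₂ → ∀ (z Nh : ℝ) (Y₁ Y₂ : ℕ), 8 ≤ z →
      Real.log z ≤ 12 * Real.sqrt (Real.log Nh) → Real.exp 16 ≤ Nh → Nh ≤ Y₁ → Y₁ ≤ Y₂ →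
      (Y₂ : ℝ) ≤ 2 * Nh → SWAbs (roughBoxMoebius z Y₁ Y₂) Nh A₁ A₂ (Ch A₁ A₂) :=
    fun A₁ A₂ hA₁ hA₂ z Nh Y₁ Y₂ hz hlz hN16 hY1 hY12 hY2 =>
      ((hCmo A₁ A₂ hA₁ hA₂).2 z Nh Y₁ Y₂ hz hlz hN16 hY1 hY12 hY2).mono (le_max_right _ _)
        (le_trans (by have := Real.add_one_le_exp (16:ℝ); linarith) hN16)
  obtain ⟨Csw, hCsw⟩ := siegelWalfiszHyp_of_dense hShiu Ch 12 hcD (K := 14) (by norm_num)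
  obtain ⟨BI, C₁, x₁, hC₁, hI⟩ := caseI_bound h6 ha he he15 hA₅ Csw
  obtain ⟨Bt, Ct, xt, hBt, hCt, hII⟩ := caseII_bound hL3 ha
  have hA₇ : 0 < 2 * A₅ + Bt + 1 := by linarith only [hA₅, hBt]
  obtain ⟨BII, Cc, xc, hCc, hcor⟩ := caseII_corners h7 ha he he1 hA₇
  obtain ⟨x₅, hx₅⟩ := eventually_sw
  obtain ⟨x₀, hx₀⟩ := eventually_genuine xs x₁ xt xc x₅ 0
  set B : ℝ := max (max BI BII) 0 with hBdef
  have hB0 : 0 ≤ B := le_max_right _ _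
  have hBI : BI ≤ B := (le_max_left _ _).trans (le_max_left _ _)
  have hBII : BII ≤ B := (le_max_right _ _).trans (le_max_left _ _)
  refine ⟨B, Cs + C₁ + (Ct / 2 + 2 * Cc), x₀, hB0, by positivity, ?_⟩
  intro x hx ι _ _ G f P Δ U Q R δ hδ hQ1 hR1 hRx hQR hΔ0 hΔ2 hΔ14 hG14 hU hP hf1 hsupp hne htype hX1 hX2 hX3
  obtain ⟨hxs, hx₁, hxt, hxc, hx₅', -, hxe⟩ := hx₀ x hx
  set z : ℝ := Real.exp (Real.sqrt (Real.log x)) with hz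
  set X' : ℝ := ∏ i ∈ G, P i with hX'
  set L : ℝ := Real.log x with hL
  -- basic sizes
  have hx0 : 0 < x := (Real.exp_pos 10).trans_le hxe
  have hL10 : 10 ≤ L := by rw [hL, Real.le_log_iff_exp_le hx0]; exact hxe
  have hL1 : 1 ≤ L := by linarith only [hL10]
  have hL0 : 0 < L := by linarith only [hL10]
  have hx1 : (1 : ℝ) < x := by
    have : (1 : ℝ) < Real.exp 10 := by have := Real.add_one_le_exp (10:ℝ); linarith
    exact this.trans_le hxe
  have hX'1 : (1 : ℝ) < X' := hx1.trans_le hX1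
  have hX'0 : 0 < X' := by linarith only [hX'1]
  have hLX : L ≤ Real.log X' := Real.log_le_log hx0 hX1
  have hlogX'0 : 0 < Real.log X' := by linarith only [hL1, hLX]
  have hP0 : ∀ i ∈ G, 0 < P i := fun i hi => zero_lt_one.trans_le (hP i hi)
  have hΔ13 : (1 + Δ) ^ 13 ≤ 2 := (pow_le_pow_right₀ (by linarith only [hΔ0]) (by norm_num)).trans hΔ14
  have hRHS0 : 0 ≤ x / Real.log x ^ A₅ := div_nonneg hx0.le (Real.rpow_nonneg hL0.le _)
  have hbound0 : ∀ {C' : ℝ}, 0 ≤ C' → C' ≤ Cs + C₁ + (Ct / 2 + 2 * Cc) →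
      ∀ {v : ℝ}, v ≤ C' * x / Real.log x ^ A₅ → v ≤ (Cs + C₁ + (Ct / 2 + 2 * Cc)) * x / Real.log x ^ A₅ := by
    intro C' hC' hle v hv
    refine hv.trans ?_
    calc C' * x / Real.log x ^ A₅ = C' * (x / Real.log x ^ A₅) := by ring
      _ ≤ (Cs + C₁ + (Ct / 2 + 2 * Cc)) * (x / Real.log x ^ A₅) := mul_le_mul_of_nonneg_right hle hRHS0
      _ = _ := by ring
  -- the levels: `QR < x/L^B ≤ x/L^{BI}, x/L^{BII}`, and `QR < x ≤ X'`
  have hlev : ∀ {B' : ℝ}, B' ≤ B → Q * R < x / Real.log x ^ B' := fun hB' =>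
    hQR.trans_le (div_le_div_of_nonneg_left hx0.le (Real.rpow_pos_of_pos hL0 _)
      (Real.rpow_le_rpow_of_exponent_le hL1 hB'))
  have hQRx : Q * R < x := by
    refine hQR.trans_le ?_
    rw [div_le_iff₀ (Real.rpow_pos_of_pos hL0 _)]
    have : 1 ≤ Real.log x ^ B := Real.one_le_rpow hL1 hB0
    nlinarith only [this, hx0]
  have hQRX : Q * R ≤ X' := by linarith only [hQRx, hX1]
  have hQx' : (⌊Q⌋₊ : ℝ) ≤ x :=
    (Nat.floor_le (by linarith only [hQ1])).trans (by nlinarith only [hQ1, hR1, hQRx])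
  have hRx' : (⌊R⌋₊ : ℝ) ≤ x :=
    (Nat.floor_le (by linarith only [hR1])).trans (by nlinarith only [hQ1, hR1, hQRx])
  -- the exponent `θ` of `R`
  set θ : ℝ := Real.log R / Real.log X' with hθdef
  have hlogR0 : 0 ≤ Real.log R := Real.log_nonneg hR1
  have hθ0 : 0 ≤ θ := div_nonneg hlogR0 hlogX'0.le
  have hRθ : R ≤ X' ^ θ := by
    rw [Real.rpow_def_of_pos hX'0, hθdef, mul_div_cancel₀ _ hlogX'0.ne', Real.exp_log (by linarith only [hR1])]
  have hε10 : ε < 1 / 10 := by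
    by_contra hge
    push Not at hge
    have : R < 1 := hRx.trans_le (Real.rpow_le_one_of_one_le_of_nonpos hx1.le (by linarith only [hge]))
    linarith only [this, hR1]
  have hθ10 : θ < 1 / 10 - ε := by
    have h1 : Real.log R < (1 / 10 - ε) * L := by
      have := Real.log_lt_log (by linarith only [hR1]) hRx
      rwa [Real.log_rpow hx0] at this
    rw [hθdef, div_lt_iff₀ hlogX'0]
    have h2 : (1 / 10 - ε) * L ≤ (1 / 10 - ε) * Real.log X' :=
      mul_le_mul_of_nonneg_left hLX (by linarith only [hε10])
    linarith only [h1, h2]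
  -- exponents
  set ex : ι → ℝ := fun i => if i ∈ G then Real.log (P i) / Real.log X' else 0 with hex
  have hesum : ∑ i, ex i = 1 := exponents_sum_univ hP0 hX'1
  have hex0 : ∀ i, 0 ≤ ex i := by
    intro i; simp only [hex]
    split_ifs with hi
    · exact div_nonneg (Real.log_nonneg (hP i hi)) hlogX'0.le
    · exact le_rfl
  set a₀ : ℝ := max (θ + 2 * e) (2 / 15) with ha₀
  set b₀ : ℝ := (1 - θ) / 3 - 2 * e with hb₀
  have ha₀pos : 0 < a₀ := lt_of_lt_of_le (by norm_num) (le_max_right _ _)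
  have ha₀θ : θ + 2 * e ≤ a₀ := le_max_left _ _
  have ha₀15 : 2 / 15 ≤ a₀ := le_max_right _ _
  have hab : 2 * a₀ ≤ b₀ := by
    rw [ha₀, hb₀]
    rcases le_total (θ + 2 * e) (2 / 15) with h | h
    · rw [max_eq_right h]; linarith only [h, hθ10, hε, hε', hedef]
    · rw [max_eq_left h]; linarith only [h, hθ10, hε, hε', hedef, hθ0]
  have hb₀13 : b₀ ≤ 1 / 3 := by rw [hb₀]; linarith only [hθ0, he]
  rcases exists_subsum_mem_Icc_or ex ha₀pos hab with ⟨s, hs1, hs2⟩ | ⟨hsmall, hbig⟩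
  · ----------------------------------------------------------------
    -- Case (16.1): a partial product `N = X'^t`, `a₀ ≤ t ≤ b₀` — Theorem 6
    ----------------------------------------------------------------
    set S : Finset ι := s.filter (· ∈ G) with hSdef
    set T : Finset ι := G.filter (· ∉ S) with hTdef
    set t : ℝ := ∑ i ∈ s, ex i with ht
    have hSG : S ⊆ G := fun i hi => (Finset.mem_filter.1 hi).2
    have hTG : T ⊆ G := Finset.filter_subset _ _
    have hNt : (∏ i ∈ S, P i) = X' ^ t := exponents_sum hP0 hX'1 s
    have hGS : G.filter (· ∈ S) = S := by
      ext i; simp only [Finset.mem_filter, hSdef]; tauto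
    have hfTS : (∏ i ∈ T, f i) * (∏ i ∈ S, f i) = ∏ i ∈ G, f i := by
      have h := Finset.prod_filter_mul_prod_filter_not G (· ∈ S) f
      rw [hGS] at h
      rw [mul_comm]; exact h
    have hPTS : (∏ i ∈ T, P i) * (∏ i ∈ S, P i) = X' := by
      have h := Finset.prod_filter_mul_prod_filter_not G (· ∈ S) P
      rw [hGS] at h
      rw [mul_comm]; exact h
    have hcardTS : T.card + S.card = G.card := by
      have h := Finset.card_filter_add_card_filter_not (s := G) (· ∈ S)
      rw [hGS] at h
      rw [add_comm]; exact h
    have ht_a : a₀ ≤ t := hs1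
    have ht_b : t ≤ b₀ := hs2
    have hSne : S.Nonempty := by
      by_contra hS
      rw [Finset.not_nonempty_iff_eq_empty] at hS
      rw [hS, Finset.prod_empty] at hNt
      have : t = 0 := by
        have h1 : X' ^ (0 : ℝ) = X' ^ t := by rw [Real.rpow_zero]; exact hNt
        exact le_antisymm ((Real.rpow_le_rpow_left_iff hX'1).1 (le_of_eq h1.symm))
          ((Real.rpow_le_rpow_left_iff hX'1).1 (le_of_eq h1))
      linarith only [this, ht_a, ha₀pos]
    have hTne : T.Nonempty := by
      by_contra hT
      rw [Finset.not_nonempty_iff_eq_empty] at hT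
      have hPTS' := hPTS
      rw [hT, Finset.prod_empty, one_mul] at hPTS'
      rw [hPTS'] at hNt
      have : t = 1 := by
        have h1 : X' ^ (1 : ℝ) = X' ^ t := by rw [Real.rpow_one]; exact hNt
        exact le_antisymm ((Real.rpow_le_rpow_left_iff hX'1).1 (le_of_eq h1.symm))
          ((Real.rpow_le_rpow_left_iff hX'1).1 (le_of_eq h1))
      linarith only [this, ht_b, hb₀13]
    have hScard : S.card ≤ 13 := by have := hTne.card_pos; omega
    have hTcard : T.card ≤ 13 := by have := hSne.card_pos; omega
    -- the bilinear form
    obtain ⟨hαs, hβs, -, hsd⟩ := sievedDisc_prod_pieces_eq_bilinDisc hP hsupp hTG hSG hTne hSne hfTS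
      hPTS hcardTS hG14 hΔ0.le hΔ14 hx0.le hX1 hX3
    have hαb : ∀ m, |(∏ i ∈ T, f i) m| ≤ (σ 0 m : ℝ) ^ 13 := abs_prod_pieces_le hTG hf1 hTcard
    have hβb : ∀ n, |(∏ i ∈ S, f i) n| ≤ (σ 0 n : ℝ) ^ 13 := abs_prod_pieces_le hSG hf1 hScard
    have hαs' : ∀ m, (∏ i ∈ T, f i) m ≠ 0 → m ∈ dyadic (∏ i ∈ T, P i) := fun m hm => (hαs m hm).1
    have hβs' : ∀ n, (∏ i ∈ S, f i) n ≠ 0 → n ∈ dyadic (∏ i ∈ S, P i) := fun n hn => (hβs n hn).1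
    have hβr : ∀ n, (∏ i ∈ S, f i) n ≠ 0 → IsRough z n := fun n hn => (hβs n hn).2
    have hsum : ∑ r ∈ (Icc 1 ⌊R⌋₊).filter (fun r : ℕ => IsCoprime (r : ℤ) a),
        δ r * ∑ q ∈ (Icc 1 ⌊Q⌋₊).filter (fun q : ℕ => IsCoprime (q : ℤ) a),
          sievedDisc (fun n => (∏ i ∈ G, f i) n) (q * r) a z x =
        ∑ r ∈ (Icc 1 ⌊R⌋₊).filter (fun r : ℕ => IsCoprime (r : ℤ) a),
          δ r * ∑ q ∈ (Icc 1 ⌊Q⌋₊).filter (fun q : ℕ => IsCoprime (q : ℤ) a),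
            bilinDisc a (∏ i ∈ T, P i) (∏ i ∈ S, P i) (⇑(∏ i ∈ T, f i)) (⇑(∏ i ∈ S, f i)) (q * r) :=
      Finset.sum_congr rfl fun r _ => by
        congr 1; exact Finset.sum_congr rfl fun q _ => by rw [hsd (q * r) a]
    rw [hsum]
    have ht1 : 2 / 15 ≤ t := ha₀15.trans ht_a
    have ht2 : t ≤ 9 / 20 := ht_b.trans (by linarith only [hb₀13])
    by_cases hd : l2Sq (∏ i ∈ S, P i) (⇑(∏ i ∈ S, f i)) * Real.log (2 * ∏ i ∈ S, P i) ^ cD < ∏ i ∈ S, P i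
    · -- sparse
      exact hbound0 hCs (by linarith only [hC₁, hCt, hCc])
        (hsp x hxs X' _ _ t Q R _ _ δ hδ hX1 hX2 hPTS hNt ht1 ht2 hQ1 hR1 hQRX hαb hαs' hβs' hd)
    · -- dense: hypothesis (A₂) from the piece of the largest box, then Theorem 6
      have hdense : (∏ i ∈ S, P i) ≤ Real.log (2 * ∏ i ∈ S, P i) ^ cD *
          l2Sq (∏ i ∈ S, P i) (⇑(∏ i ∈ S, f i)) := by rw [mul_comm]; exact not_lt.1 hd
      obtain ⟨i₀, hi₀, hmax⟩ := S.exists_max_image P hSne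
      have hc1 : (1 : ℝ) / 100 ≤ 2 / 15 / 13 := by norm_num
      have hc2 : (2 : ℝ) / 15 / 13 ≤ 1 := by norm_num
      obtain ⟨hbig', hzP', hlogz'⟩ := hx₅ x hx₅' (2 / 15 / 13) hc1 hc2
      have hPi₀ : x ^ ((2 : ℝ) / 15 / 13) ≤ P i₀ := by
        have h13 := rpow_inv_thirteen_le_max (fun i hi => hP i (hSG hi)) hScard hi₀ hmax
        refine le_trans ?_ h13
        rw [show (∏ i ∈ S, P i) = X' ^ t from hNt, ← Real.rpow_mul hX'0.le]
        calc x ^ ((2 : ℝ) / 15 / 13) ≤ X' ^ ((2 : ℝ) / 15 / 13) := Real.rpow_le_rpow hx0.le hX1 (by norm_num)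
          _ ≤ X' ^ (t * (1 / 13)) := Real.rpow_le_rpow_of_exponent_le hX'1.le (by linarith only [ht1])
      have hbigP : Real.exp 16 + 1 ≤ P i₀ := hbig'.trans hPi₀
      have hz8 : 8 ≤ z := by
        have h3 : (3 : ℝ) ≤ Real.sqrt L := by
          rw [show (3:ℝ) = Real.sqrt 9 by rw [show (9:ℝ) = 3 ^ 2 by norm_num, Real.sqrt_sq (by norm_num)]]
          exact Real.sqrt_le_sqrt (by linarith only [hL10])
        have h4 : Real.exp 3 ≤ z := Real.exp_le_exp.2 h3
        have h5 : (8 : ℝ) ≤ Real.exp 3 := by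
          have h7 : (2 : ℝ) ≤ Real.exp 1 := by have := Real.add_one_le_exp (1:ℝ); norm_num at this; linarith
          have h6 : Real.exp 3 = Real.exp 1 ^ 3 := by rw [← Real.exp_nat_mul]; norm_num
          rw [h6]
          calc (8 : ℝ) = 2 ^ 3 := by norm_num
            _ ≤ Real.exp 1 ^ 3 := pow_le_pow_left₀ (by norm_num) h7 3
        exact h5.trans h4
      have hzP : z ^ 2 ≤ P i₀ / 2 := hzP'.trans (by linarith only [hPi₀])
      have hlogz : Real.log z ≤ 12 * Real.sqrt (Real.log (P i₀ / 2)) := by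
        rw [hz, Real.log_exp]
        refine hlogz'.trans (mul_le_mul_of_nonneg_left (Real.sqrt_le_sqrt ?_) (by norm_num))
        have hxc0 : 0 < x ^ ((2 : ℝ) / 15 / 13) / 2 := by positivity
        exact Real.log_le_log hxc0 (by linarith only [hPi₀])
      have htype' : ∀ i ∈ G, (⇑(f i) = roughBoxOne z ⌊P i⌋₊ ⌊(1 + Δ) * P i⌋₊) ∨
          (P i < U ∧ ⇑(f i) = roughBoxMoebius z ⌊P i⌋₊ (min ⌊(1 + Δ) * P i⌋₊ U)) := by
        intro i hi
        rcases htype i hi with ⟨h1', -⟩ | h2'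
        · exact Or.inl h1'
        · exact Or.inr h2'
      have hsw : SiegelWalfiszHyp (∏ i ∈ S, P i) 2 Csw ⇑(∏ i ∈ S, f i) :=
        siegelWalfiszHyp_prod_pieces hCh1 hCh2 hCsw hP hf1 hsupp htype' hSG hScard hΔ0.le hΔ2 hΔ13 hi₀ hmax
          hbigP hz8 hzP hlogz hdense
      have hta : θ + 2 * e ≤ t := ha₀θ.trans ht_a
      exact hbound0 hC₁ (by linarith only [hCs, hCt, hCc])
        (hI x hx₁ X' _ _ t θ z Q R _ _ δ hδ hX1 hX2 hPTS hNt hQ1 hR1 hθ0 hRθ (hlev hBI) hta ht_b ht1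
          le_rfl hαb hβb hβr hsw)
  · ----------------------------------------------------------------
    -- Case (16.2): at most three pieces of exponent `> b₀` — Theorem 7*
    ----------------------------------------------------------------
    set Big : Finset ι := Finset.univ.filter (fun i => a₀ ≤ ex i) with hBigdef
    have ha₀1 : a₀ < 1 := by rw [ha₀]; exact max_lt (by linarith only [hθ10, hε, he15]) (by norm_num)
    have hb₀big : 0.29 < b₀ := by rw [hb₀]; linarith only [hθ10, hε, hε', hedef]
    have hBigG : ∀ i ∈ Big, i ∈ G := by
      intro i hi
      by_contra hni
      have h1 : ex i = 0 := by simp [hex, hni]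
      have h2 : a₀ ≤ ex i := (Finset.mem_filter.1 hi).2
      linarith only [h1, h2, ha₀pos]
    have hBigne : Big.Nonempty := by
      by_contra hno
      rw [Finset.not_nonempty_iff_eq_empty, Finset.filter_eq_empty_iff] at hno
      have hfil : Finset.univ.filter (fun i => ex i < a₀) = Finset.univ := by
        ext i
        simp only [Finset.mem_filter, Finset.mem_univ, true_and, iff_true]
        exact not_le.1 (hno (Finset.mem_univ i))
      rw [hfil, hesum] at hsmall
      linarith only [hsmall, ha₀1]
    have hexBig : ∀ i ∈ Big, b₀ < ex i := fun i hi => hbig i (Finset.mem_filter.1 hi).2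
    have hexi : ∀ i ∈ G, ex i = Real.log (P i) / Real.log X' := fun i hi => by simp [hex, hi]
    have hPex : ∀ i ∈ G, P i = X' ^ (ex i) := by
      intro i hi
      rw [hexi i hi, Real.rpow_def_of_pos hX'0, mul_div_cancel₀ _ hlogX'0.ne', Real.exp_log (hP0 i hi)]
    -- big pieces are box indicators (a Möbius piece has exponent `< 1/7 + o(1) < b₀`)
    have hlog2 : Real.log 2 < 0.6931471808 := Real.log_two_lt_d9
    have hBigbox : ∀ i ∈ Big, ⇑(f i) = roughBoxOne z ⌊P i⌋₊ ⌊(1 + Δ) * P i⌋₊ := by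
      intro i hi
      have hiG := hBigG i hi
      rcases htype i hiG with ⟨h1, -⟩ | ⟨hPU, -⟩
      · exact h1
      · exfalso
        have hPi0 : 0 < P i := hP0 i hiG
        have hlt : Real.log (P i) < 2 * Real.log 2 + L / 7 := by
          have h1 : Real.log (P i) < Real.log (4 * x ^ (1 / 7 : ℝ)) :=
            Real.log_lt_log hPi0 (hPU.trans_le hU)
          rw [Real.log_mul (by norm_num) (Real.rpow_pos_of_pos hx0 _).ne', Real.log_rpow hx0, ← hL,
            show (4 : ℝ) = 2 ^ 2 by norm_num, Real.log_pow] at h1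
          push_cast at h1
          linarith only [h1]
        have hlogP0 : 0 ≤ Real.log (P i) := Real.log_nonneg (hP i hiG)
        have he_le : ex i ≤ Real.log (P i) / L := by
          rw [hexi i hiG]; exact div_le_div_of_nonneg_left hlogP0 hL0 hLX
        have he_lt : ex i < (2 * Real.log 2 + L / 7) / L :=
          lt_of_le_of_lt he_le (div_lt_div_of_pos_right hlt hL0)
        have hfrac : (2 * Real.log 2 + L / 7) / L ≤ 0.14 + 1 / 7 := by
          rw [div_le_iff₀ hL0]; nlinarith only [hlog2, hL10]
        linarith only [hexBig i hi, he_lt, hfrac, hb₀big]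
    have hex_le1 : ∀ i, ex i ≤ 1 := by
      intro i
      rw [← hesum]
      exact Finset.single_le_sum (fun j _ => hex0 j) (Finset.mem_univ i)
    -- the largest big piece `i₁`: the variable `m`
    obtain ⟨i₁, hi₁, hmax₁⟩ := Big.exists_max_image P hBigne
    have hi₁G : i₁ ∈ G := hBigG i₁ hi₁
    have hP₁1 : 1 ≤ P i₁ := hP i₁ hi₁G
    have hP₁0 : 0 < P i₁ := hP0 i₁ hi₁G
    have hν₁ : b₀ < ex i₁ := hexBig i₁ hi₁
    have hg₁ : ∀ m : ℕ, f i₁ m = if m ∈ Ioc ⌊P i₁⌋₊ ⌊(1 + Δ) * P i₁⌋₊ then roughIndicator z m else 0 := by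
      intro m
      have := congrFun (hBigbox i₁ hi₁) m
      rw [this, roughBoxOne_eq_ite_Ioc]
    -- corners in `m`
    have hMcorner : ∀ M ∈ ({P i₁, (1 + Δ) * P i₁} : Finset ℝ), X' ^ (ex i₁) ≤ M ∧ 1 ≤ M ∧ P i₁ ≤ M ∧ M ≤ 2 * P i₁ := by
      intro M hM
      rw [Finset.mem_insert, Finset.mem_singleton] at hM
      have h1 : X' ^ (ex i₁) = P i₁ := (hPex i₁ hi₁G).symm
      rcases hM with rfl | rfl
      · exact ⟨h1.le, hP₁1, le_rfl, by linarith only [hP₁1]⟩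
      · refine ⟨?_, ?_, ?_, ?_⟩ <;> nlinarith only [h1.le, h1.ge, hΔ0, hΔ2, hP₁1]
    -- the parameters `η`, `W`
    set W : ℝ := Cc * x / Real.log x ^ (2 * A₅ + Bt + 1) with hWdef
    have hW0 : 0 ≤ W := by rw [hWdef]; positivity
    set η : ℝ := L ^ (-(A₅ + Bt + 1)) with hηdef
    have hη : 0 < η := Real.rpow_pos_of_pos hL0 _
    have hηalg := caseII_eta_algebra (A₅ := A₅) (Bt := Bt) (Cc := Cc) hL1 hx0.le hCt
    -- rough support of the pieces
    have hrough : ∀ i ∈ G, ∀ n : ℕ, f i n ≠ 0 → IsRough z n := fun i hi n hn => (hsupp i hi n hn).2.2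
    ----------------------------------------------------------------
    -- the common tail: given the second variable and the cofactor, apply Theorem 7*
    ----------------------------------------------------------------
    have htail : ∀ (T : Finset ι) (g₂ : ArithmeticFunction ℝ) (Nlo Nhi Nb : ℝ),
        T ⊆ G → i₁ ∉ T → T.card ≤ 13 →
        (∏ i ∈ G, f i) = (∏ i ∈ T, f i) * f i₁ * g₂ →
        (∀ n : ℕ, g₂ n = if n ∈ Ioc ⌊Nlo⌋₊ ⌊Nhi⌋₊ then roughIndicator z n else 0) →
        0 ≤ Nlo → Nlo ≤ Nhi → 1 ≤ Nb → Nhi ≤ 2 * Nb → 1 ≤ Nhi →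
        (∀ N ∈ ({Nlo, Nhi} : Finset ℝ), 1 ≤ N → Nb ≤ N) →
        (∏ i ∈ T, P i) * P i₁ * Nb = X' →
        (1 + Δ) ^ T.card * (∏ i ∈ T, P i) * ((1 + Δ) * P i₁) * Nhi ≤ 2 * x →
        (∀ n ∈ Ioc ⌊Nlo⌋₊ ⌊Nhi⌋₊, Nb ≤ (n : ℝ)) →
        (∑ i ∈ T, ex i) + θ < 1 / 2 - e → (∑ i ∈ T, ex i) / 2 + θ < ex i₁ - e →
        |∑ r ∈ (Icc 1 ⌊R⌋₊).filter (fun r : ℕ => IsCoprime (r : ℤ) a),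
            δ r * ∑ q ∈ (Icc 1 ⌊Q⌋₊).filter (fun q : ℕ => IsCoprime (q : ℤ) a),
              sievedDisc (fun n => (∏ i ∈ G, f i) n) (q * r) a z x| ≤
          (Ct / 2 + 2 * Cc) * x / Real.log x ^ A₅ := by
      intro T g₂ Nlo Nhi Nb hTG hi₁T hTcard hF hg₂ hNlo0 hNN hNb1 hNhi2 hNhi1 hNcorner hXeq hhigh hnlow h145 h146
      set c : ArithmeticFunction ℝ := ∏ i ∈ T, f i with hcdef
      set ℓ : ℝ := ∑ i ∈ T, ex i with hℓdef
      set LT : ℝ := ∏ i ∈ T, P i with hLTdef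
      set L₂ : ℝ := (1 + Δ) ^ T.card * LT with hL₂def
      set L₁ : ℝ := if T = ∅ then 1 / 2 else LT with hL₁def
      have hLT1 : 1 ≤ LT := one_le_prod_pieces hTG hP
      have hLT0 : 0 < LT := by linarith only [hLT1]
      have hLTℓ : LT = X' ^ ℓ := by
        have h := exponents_sum hP0 hX'1 T
        have hfil : T.filter (· ∈ G) = T := by
          ext i; simp only [Finset.mem_filter]; exact ⟨fun h => h.1, fun h => ⟨h, hTG h⟩⟩
        rw [hfil] at h
        exact h
      have hΔ1 : (1 : ℝ) ≤ 1 + Δ := by linarith only [hΔ0]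
      have hpowT : (1 : ℝ) ≤ (1 + Δ) ^ T.card := one_le_pow₀ hΔ1
      have hpowT2 : (1 + Δ) ^ T.card ≤ 2 := (pow_le_pow_right₀ hΔ1 (by omega : T.card ≤ 14)).trans hΔ14
      have hL₂1 : 1 ≤ L₂ := by rw [hL₂def]; exact one_le_mul_of_one_le_of_one_le hpowT hLT1
      have hL₂LT : LT ≤ L₂ := by rw [hL₂def]; exact le_mul_of_one_le_left hLT0.le hpowT
      have hL₂2 : L₂ ≤ 2 * X' ^ ℓ := by rw [hL₂def, ← hLTℓ]; exact mul_le_mul_of_nonneg_right hpowT2 hLT0.le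
      have hL₂2LT : L₂ ≤ 2 * LT := by rw [hL₂def]; exact mul_le_mul_of_nonneg_right hpowT2 hLT0.le
      -- the `l`-range
      set SL : Finset ℕ := (Ioc ⌊L₁⌋₊ ⌊L₂⌋₊).filter (fun l => IsRough z l) with hSLdef
      have hSLr : ∀ l ∈ SL, IsRough z l := fun l hl => (Finset.mem_filter.1 hl).2
      have hSLsub : SL ⊆ Ioc ⌊L₁⌋₊ ⌊L₂⌋₊ := Finset.filter_subset _ _
      have hSL : ∀ l, c l ≠ 0 → l ∈ SL := by
        intro l hl
        rw [hSLdef, Finset.mem_filter, Finset.mem_Ioc, hL₁def]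
        by_cases hT : T = ∅
        · rw [if_pos hT]
          have hl1 : l = 1 := by
            by_contra h; apply hl; rw [hcdef, hT, Finset.prod_empty]; exact ArithmeticFunction.one_apply_ne h
          subst hl1
          have hL₂' : L₂ = 1 := by rw [hL₂def, hLTdef, hT]; simp
          refine ⟨⟨by norm_num, ?_⟩, fun p hp => by simp at hp⟩
          rw [hL₂', Nat.floor_one]
        · have hTne : T.Nonempty := Finset.nonempty_iff_ne_empty.2 hT
          rw [if_neg hT]
          obtain ⟨h1, h2, h3⟩ := prod_pieces_support hTG hTne hP hsupp hl
          refine ⟨⟨(Nat.floor_lt hLT0.le).2 h1, Nat.le_floor h2⟩, h3⟩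
      -- lower ends: `l ≥ LT` on `SL`
      have hlLT : ∀ l ∈ SL, LT ≤ (l : ℝ) := by
        intro l hl
        have hl' := Finset.mem_Ioc.1 (Finset.mem_filter.1 hl).1
        by_cases hT : T = ∅
        · have hLT' : LT = 1 := by rw [hLTdef, hT, Finset.prod_empty]
          rw [hL₁def, if_pos hT] at hl'
          have h0 : ⌊(1 / 2 : ℝ)⌋₊ = 0 := Nat.floor_eq_zero.2 (by norm_num)
          rw [h0] at hl'
          rw [hLT']
          exact_mod_cast hl'.1
        · rw [hL₁def, if_neg hT] at hl'
          exact ((Nat.floor_lt hLT0.le).1 hl'.1).le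
      have hc13 : ∀ l, |c l| ≤ (σ 0 l : ℝ) ^ 13 := abs_prod_pieces_le hTG hf1 hTcard
      -- the boxes of `m` and `n`
      have hΔP0 : 0 ≤ (1 + Δ) * P i₁ := mul_nonneg (by linarith only [hΔ0]) hP₁0.le
      have hMM : P i₁ ≤ (1 + Δ) * P i₁ := le_mul_of_one_le_left hP₁0.le (by linarith only [hΔ0])
      have hK : ∀ l ∈ SL, ∀ m ∈ Ioc ⌊P i₁⌋₊ ⌊(1 + Δ) * P i₁⌋₊, ∀ n ∈ Ioc ⌊Nlo⌋₊ ⌊Nhi⌋₊,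
          l * m * n ∈ Ioc ⌊x⌋₊ ⌊2 * x⌋₊ := by
        intro l hl m hm n hn
        have hm' := Finset.mem_Ioc.1 hm
        have hlge := hlLT l hl
        have hL₂0 : 0 ≤ L₂ := by linarith only [hL₂1]
        have hlle : (l : ℝ) ≤ L₂ := by
          have := (Finset.mem_Ioc.1 (Finset.mem_filter.1 hl).1).2
          exact (Nat.le_floor_iff hL₂0).1 this
        have hmgt : P i₁ < (m : ℝ) := (Nat.floor_lt hP₁0.le).1 hm'.1
        have hmle : (m : ℝ) ≤ (1 + Δ) * P i₁ := (Nat.le_floor_iff hΔP0).1 hm'.2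
        have hnge : Nb ≤ (n : ℝ) := hnlow n hn
        have hNhi0 : 0 ≤ Nhi := by linarith only [hNhi1]
        have hnle : (n : ℝ) ≤ Nhi := (Nat.le_floor_iff hNhi0).1 (Finset.mem_Ioc.1 hn).2
        have hm0 : (0 : ℝ) ≤ m := Nat.cast_nonneg _
        have hNb0 : 0 ≤ Nb := by linarith only [hNb1]
        rw [Finset.mem_Ioc]
        constructor
        · -- `x ≤ X' = LT · P i₁ · Nb < l m n`
          have h1 : x < ((l * m * n : ℕ) : ℝ) := by
            push_cast
            have h2 : LT * P i₁ * Nb < LT * m * Nb :=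
              mul_lt_mul_of_pos_right (mul_lt_mul_of_pos_left hmgt hLT0) (by linarith only [hNb1])
            have h3 : LT * m * Nb ≤ (l : ℝ) * m * n :=
              mul_le_mul (mul_le_mul_of_nonneg_right hlge hm0) hnge hNb0 (by positivity)
            linarith only [h2, h3, hXeq, hX1]
          exact (Nat.floor_lt hx0.le).2 h1
        · have h1 : ((l * m * n : ℕ) : ℝ) ≤ 2 * x := by
            push_cast
            calc (l : ℝ) * m * n ≤ L₂ * ((1 + Δ) * P i₁) * Nhi :=
                  mul_le_mul (mul_le_mul hlle hmle hm0 hL₂0) hnle (Nat.cast_nonneg _) (mul_nonneg hL₂0 hΔP0)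
              _ = (1 + Δ) ^ T.card * LT * ((1 + Δ) * P i₁) * Nhi := by rw [hL₂def]
              _ ≤ 2 * x := hhigh
          exact Nat.le_floor h1
      -- the corners
      have hcorner : ∀ M ∈ ({P i₁, (1 + Δ) * P i₁} : Finset ℝ), ∀ N ∈ ({Nlo, Nhi} : Finset ℝ), 1 ≤ N →
          deltaStar a z M N L₂ Q R ≤ W := by
        intro M hM N hN hN1
        obtain ⟨hMν, hM1, hMlo, hMhi⟩ := hMcorner M hM
        have hNb : Nb ≤ N := hNcorner N hN hN1
        have hNhi : N ≤ Nhi := by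
          rw [Finset.mem_insert, Finset.mem_singleton] at hN
          rcases hN with rfl | rfl
          · exact hNN
          · exact le_rfl
        have hL₂0 : 0 ≤ L₂ := by linarith only [hL₂1]
        have hM0 : 0 ≤ M := by linarith only [hM1]
        have hXlo : X' ≤ L₂ * M * N := by
          rw [← hXeq]
          exact mul_le_mul (mul_le_mul hL₂LT hMlo hP₁0.le hL₂0) hNb (by linarith only [hNb1]) (mul_nonneg hL₂0 hM0)
        have hXhi : L₂ * M * N ≤ 2 ^ 18 * x := by
          have h1 : L₂ * M * N ≤ (2 * LT) * (2 * P i₁) * (2 * Nb) := by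
            refine mul_le_mul (mul_le_mul hL₂2LT hMhi hM0 (by linarith only [hLT1])) (hNhi.trans hNhi2)
              (by linarith only [hN1]) (mul_nonneg (by linarith only [hLT1]) (by linarith only [hP₁1]))
          have h2 : (2 * LT) * (2 * P i₁) * (2 * Nb) = 8 * X' := by rw [← hXeq]; ring
          calc L₂ * M * N ≤ (2 * LT) * (2 * P i₁) * (2 * Nb) := h1
            _ = 8 * X' := h2
            _ ≤ 8 * (2 ^ 15 * x) := by linarith only [hX2]
            _ = 2 ^ 18 * x := by ring
        exact hcor x hxc X' θ ℓ (ex i₁) L₂ M N Q R hX1 hX2 hQ1 hR1 hRθ (hlev hBII) hL₂1 hL₂2 hMν hM1 hN1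
          hXlo hXhi h145 h146
      have hF' : (∏ i ∈ G, f i) = c * f i₁ * g₂ := hF
      rw [hF']
      have hb := hII x hxt z c (f i₁) g₂ SL L₁ L₂ (P i₁) ((1 + Δ) * P i₁) Nlo Nhi Q R W η δ hSL hSLr hc13
        hSLsub hg₁ hg₂ hK hMM hNN (by linarith only [hQ1]) hQx' hRx' hδ hW0 hcorner hη
      exact hb.trans hηalg
    ----------------------------------------------------------------
    -- the second big piece, if any
    ----------------------------------------------------------------
    rcases (Big.erase i₁).eq_empty_or_nonempty with hB1 | hB2
    · -- `k = 1`: the variable `n` is trivial (`N = 1`)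
      set T : Finset ι := G.erase i₁ with hTdef
      have hTG : T ⊆ G := Finset.erase_subset _ _
      have hi₁T : i₁ ∉ T := Finset.notMem_erase i₁ G
      have hcardT : T.card + 1 = G.card := Finset.card_erase_add_one hi₁G
      have hfT : f i₁ * ∏ i ∈ T, f i = ∏ i ∈ G, f i := Finset.mul_prod_erase G f hi₁G
      have hPT : P i₁ * ∏ i ∈ T, P i = X' := Finset.mul_prod_erase G P hi₁G
      have hF : (∏ i ∈ G, f i) = (∏ i ∈ T, f i) * f i₁ * 1 := by rw [← hfT]; ring
      -- the exponent of the cofactor is small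
      have hsmallT : ∀ i ∈ T, ex i < a₀ := by
        intro i hi
        have hne : i ≠ i₁ := Finset.ne_of_mem_erase hi
        by_contra hge
        push Not at hge
        have : i ∈ Big.erase i₁ := Finset.mem_erase.2 ⟨hne, Finset.mem_filter.2 ⟨Finset.mem_univ _, hge⟩⟩
        rw [hB1] at this
        exact Finset.notMem_empty _ this
      have hℓ : (∑ i ∈ T, ex i) < a₀ := by
        refine lt_of_le_of_lt ?_ hsmall
        exact Finset.sum_le_sum_of_subset_of_nonneg
          (fun i hi => Finset.mem_filter.2 ⟨Finset.mem_univ _, hsmallT i hi⟩) fun i _ _ => hex0 i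
      have hℓν : (∑ i ∈ T, ex i) + ex i₁ = 1 := by
        have h1 : ∑ i ∈ G, ex i = 1 := by
          rw [← hesum]
          refine Finset.sum_subset (Finset.subset_univ _) fun i _ hi => ?_
          simp [hex, hi]
        rw [← h1, ← Finset.add_sum_erase G ex hi₁G, add_comm]
      have h145 : (∑ i ∈ T, ex i) + θ < 1 / 2 - e := by
        rcases lt_max_iff.1 (lt_of_lt_of_le hℓ le_rfl) with h | h <;>
          linarith only [h, hθ10, hθ0, hε, hε', hedef, hℓν]
      have h146 : (∑ i ∈ T, ex i) / 2 + θ < ex i₁ - e := by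
        rcases lt_max_iff.1 (lt_of_lt_of_le hℓ le_rfl) with h | h <;>
          linarith only [h, hθ10, hθ0, hε, hε', hedef, hℓν]
      have hhigh : (1 + Δ) ^ T.card * (∏ i ∈ T, P i) * ((1 + Δ) * P i₁) * 1 ≤ 2 * x := by
        calc (1 + Δ) ^ T.card * (∏ i ∈ T, P i) * ((1 + Δ) * P i₁) * 1
            = (1 + Δ) ^ (T.card + 1) * (P i₁ * ∏ i ∈ T, P i) := by rw [pow_succ]; ring
          _ = (1 + Δ) ^ G.card * X' := by rw [hcardT, hPT]
          _ ≤ 2 * x := hX3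
      refine hbound0 (by linarith only [hCt, hCc]) (by linarith only [hCs, hC₁]) (htail T 1 0 1 1 hTG hi₁T
        (by omega) hF (one_apply_eq_ite_Ioc z) le_rfl zero_le_one le_rfl (by norm_num) le_rfl ?_ ?_ hhigh ?_
        h145 h146)
      · intro N _ hN1; exact hN1
      · rw [mul_one, mul_comm]; exact hPT
      · intro n hn
        rw [Nat.floor_zero, Nat.floor_one, Finset.mem_Ioc] at hn
        have : n = 1 := by omega
        subst this; norm_num
    · -- `k ≥ 2`: a second big piece `i₂` is the variable `n`
      obtain ⟨i₂, hi₂'⟩ := hB2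
      have hi₂ : i₂ ∈ Big := Finset.mem_of_mem_erase hi₂'
      have hne21 : i₂ ≠ i₁ := Finset.ne_of_mem_erase hi₂'
      have hi₂G : i₂ ∈ G := hBigG i₂ hi₂
      have hP₂1 : 1 ≤ P i₂ := hP i₂ hi₂G
      have hP₂0 : 0 < P i₂ := hP0 i₂ hi₂G
      have hν₂ : b₀ < ex i₂ := hexBig i₂ hi₂
      have hi₂e : i₂ ∈ G.erase i₁ := Finset.mem_erase.2 ⟨hne21, hi₂G⟩
      set T : Finset ι := (G.erase i₁).erase i₂ with hTdef
      have hTG : T ⊆ G := (Finset.erase_subset _ _).trans (Finset.erase_subset _ _)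
      have hi₁T : i₁ ∉ T := fun h => Finset.notMem_erase i₁ G (Finset.mem_of_mem_erase h)
      have hcardT : T.card + 2 = G.card := by
        have h1 : T.card + 1 = (G.erase i₁).card := Finset.card_erase_add_one hi₂e
        have h2 : (G.erase i₁).card + 1 = G.card := Finset.card_erase_add_one hi₁G
        omega
      have hfT : f i₁ * (f i₂ * ∏ i ∈ T, f i) = ∏ i ∈ G, f i := by
        rw [Finset.mul_prod_erase (G.erase i₁) f hi₂e, Finset.mul_prod_erase G f hi₁G]
      have hPT : P i₁ * (P i₂ * ∏ i ∈ T, P i) = X' := by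
        rw [Finset.mul_prod_erase (G.erase i₁) P hi₂e, Finset.mul_prod_erase G P hi₁G]
      have hF : (∏ i ∈ G, f i) = (∏ i ∈ T, f i) * f i₁ * f i₂ := by rw [← hfT]; ring
      have hg₂ : ∀ n : ℕ, f i₂ n = if n ∈ Ioc ⌊P i₂⌋₊ ⌊(1 + Δ) * P i₂⌋₊ then roughIndicator z n else 0 := by
        intro n
        have := congrFun (hBigbox i₂ hi₂) n
        rw [this, roughBoxOne_eq_ite_Ioc]
      -- exponents: `ℓ = 1 − ν₁ − ν₂`
      have hℓν : (∑ i ∈ T, ex i) + ex i₁ + ex i₂ = 1 := by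
        have h1 : ∑ i ∈ G, ex i = 1 := by
          rw [← hesum]
          refine Finset.sum_subset (Finset.subset_univ _) fun i _ hi => ?_
          simp [hex, hi]
        rw [← h1, ← Finset.add_sum_erase G ex hi₁G, ← Finset.add_sum_erase (G.erase i₁) ex hi₂e]
        ring
      obtain ⟨h145, h146⟩ := range_theorem7Star_of_two_le hθ10 (le_refl θ) he h5e hν₁ hν₂
        (le_of_eq (by linarith only [hℓν] : (∑ i ∈ T, ex i) = 1 - ex i₁ - ex i₂))
      have hhigh : (1 + Δ) ^ T.card * (∏ i ∈ T, P i) * ((1 + Δ) * P i₁) * ((1 + Δ) * P i₂) ≤ 2 * x := by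
        calc (1 + Δ) ^ T.card * (∏ i ∈ T, P i) * ((1 + Δ) * P i₁) * ((1 + Δ) * P i₂)
            = (1 + Δ) ^ (T.card + 2) * (P i₁ * (P i₂ * ∏ i ∈ T, P i)) := by rw [pow_add]; ring
          _ = (1 + Δ) ^ G.card * X' := by rw [hcardT, hPT]
          _ ≤ 2 * x := hX3
      have hN2lo : P i₂ ≤ (1 + Δ) * P i₂ := le_mul_of_one_le_left hP₂0.le (by linarith only [hΔ0])
      refine hbound0 (by linarith only [hCt, hCc]) (by linarith only [hCs, hC₁]) (htail T (f i₂) (P i₂)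
        ((1 + Δ) * P i₂) (P i₂) hTG hi₁T (by omega) hF hg₂ hP₂0.le hN2lo hP₂1
        (by nlinarith only [hΔ2, hP₂0]) (by nlinarith only [hΔ0, hP₂1]) ?_ ?_ hhigh ?_ h145 h146)
      · intro N hN _
        rw [Finset.mem_insert, Finset.mem_singleton] at hN
        rcases hN with rfl | rfl
        · exact le_rfl
        · exact hN2lo
      · rw [← hPT]; ring
      · intro n hn
        exact ((Nat.floor_lt hP₂0.le).1 (Finset.mem_Ioc.1 hn).1).le


/-! ### From an interior box-tuple to the genuine pieces -/

/-- **The interior box-tuples, for the pair sum of Theorem 9 (BFI §15 p. 245–246 with §16 p. 250).**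
For an interior tuple `κ` of boxes (product box inside `(x, 2x]`) of a Heath-Brown piece with
`1 ≤ j ≤ 7`, truncation `1 ≤ U ≤ 4x^{1/7}`, box ratio `1 + Δ` with `(1+Δ)^{14} ≤ 2`, `Δ ≤ 1/2`, sifting
level `z = exp(√log x)`, and moduli `qr`, `q ≤ Q`, `r ≤ R` (`Q, R ≥ 1`, `R < x^{1/10−ε}`,
`QR < xℒ^{−B}`) with weights `1_{(q,a)=1}`, `δ_r 1_{(r,a)=1}`, `|δ| ≤ 1`:
`|∑_r δ_r ∑_q sievedDisc (PMain κ) (qr) a z x| ≤ C x (log x)^{−A₅}` for `x ≥ x₀`.  The factors whose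
box lies below `1` are Dirichlet units (`factorMain_eq_one`) and are discarded; the remaining
("genuine") factors form a family as in `genuine_pieces_bound9` (this passage is that of
`BFI.interior_tuple_bound` verbatim). [cite: BombieriFriedlanderIwaniecActa1986, §15 p. 245–246; §16 p. 250] -/
theorem interior_tuple_bound9
    (h6 : BombieriFriedlanderIwaniecTheorem6) (h7 : BombieriFriedlanderIwaniecTheorem7Star)
    (hL3 : BombieriFriedlanderIwaniecLemma3) (hShiu : Shiu1980BrunTitchmarsh)
    (hSWμ : LFunctions.SiegelWalfiszMoebius) (hFL : SieveSequence.fundamental_lemma_uniform)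
    {a : ℤ} (ha : a ≠ 0) {ε : ℝ} (hε : 0 < ε) (hε' : ε ≤ 1 / 100) {A₅ : ℝ} (hA₅ : 0 ≤ A₅) :
    ∃ B C x₀ : ℝ, 0 ≤ B ∧ 0 ≤ C ∧ ∀ x : ℝ, x₀ ≤ x →
      ∀ (Δ : ℝ) (U j K : ℕ) (κ : Fin (2 * j) → ℕ) (Q R : ℝ) (δ : ℕ → ℝ),
      (∀ r, |δ r| ≤ 1) → 1 ≤ Q → 1 ≤ R → R < x ^ (1 / 10 - ε) → Q * R < x / Real.log x ^ B →
      1 ≤ j → j ≤ 7 → 0 < Δ → Δ ≤ 1 / 2 → (1 + Δ) ^ 14 ≤ 2 →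
      1 ≤ U → (U : ℝ) ≤ 4 * x ^ (1 / 7 : ℝ) → κ ∈ tuples j K → Interior x Δ j κ →
      |∑ r ∈ (Icc 1 ⌊R⌋₊).filter (fun r : ℕ => IsCoprime (r : ℤ) a),
          δ r * ∑ q ∈ (Icc 1 ⌊Q⌋₊).filter (fun q : ℕ => IsCoprime (q : ℤ) a),
            sievedDisc (fun n => prodMain x (Real.exp (Real.sqrt (Real.log x))) Δ U j κ n) (q * r) a
              (Real.exp (Real.sqrt (Real.log x))) x| ≤ C * x / Real.log x ^ A₅ := by
  obtain ⟨B, C, x₀, hB, hC, hmain⟩ := genuine_pieces_bound9 h6 h7 hL3 hShiu hSWμ hFL ha hε hε' hA₅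
  refine ⟨B, C, max x₀ 1, hB, hC, fun x hx Δ U j K κ Q R δ hδ hQ1 hR1 hRx hQR hj hj7 hΔ0 hΔ2 hΔ14 hU1 hU _ hInt => ?_⟩
  have hx₀ : x₀ ≤ x := le_trans (le_max_left _ _) hx
  have hx1 : (1 : ℝ) ≤ x := le_trans (le_max_right _ _) hx
  have hx0 : 0 < x := by linarith
  have hΔ' : -1 < Δ := by linarith
  set z : ℝ := Real.exp (Real.sqrt (Real.log x)) with hz
  -- the pieces and the scales
  set f : Fin (2 * j) → ArithmeticFunction ℝ := fun i => factorMain x z Δ U j i (κ i) with hf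
  set P : Fin (2 * j) → ℝ := fun i => boxLow (2 * x) Δ (κ i) with hP
  have hprod : prodMain x z Δ U j κ = ∏ i, f i := rfl
  have hRHS : 0 ≤ C * x / Real.log x ^ A₅ :=
    div_nonneg (mul_nonneg hC hx0.le) (Real.rpow_nonneg (Real.log_nonneg hx1) _)
  -- a zero factor kills everything
  by_cases hzero : ∃ i, f i = 0
  · obtain ⟨i, hi⟩ := hzero
    have h0 : prodMain x z Δ U j κ = 0 := by rw [hprod]; exact Finset.prod_eq_zero (Finset.mem_univ i) hi
    have : ∀ d, sievedDisc (fun n => prodMain x z Δ U j κ n) d a z x = 0 := by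
      intro d; rw [h0]; exact sievedDisc_zero d a z x
    simp only [this, mul_zero, Finset.sum_const_zero, abs_zero]
    exact hRHS
  push Not at hzero
  -- genuine slots
  set G : Finset (Fin (2 * j)) := Finset.univ.filter (fun i => 1 ≤ P i) with hGdef
  have hPG : ∀ i ∈ G, 1 ≤ P i := fun i hi => (Finset.mem_filter.1 hi).2
  have hP0 : ∀ i, 0 < P i := fun i => boxLow_pos (by linarith) hΔ' (κ i)
  have hf1 : ∀ i ∈ G, ∀ n, |f i n| ≤ 1 := fun i _ n => abs_factorMain_le_one i.isLt (κ i) n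
  have hsupp : ∀ i ∈ G, ∀ n : ℕ, f i n ≠ 0 → P i < n ∧ (n : ℝ) ≤ (1 + Δ) * P i ∧ IsRough z n :=
    fun i _ n hn => factorMain_support hΔ' (κ i) hn
  have hneG : ∀ i ∈ G, f i ≠ 0 := fun i _ => hzero i
  -- the non-genuine slots carry units, and their boxes straddle `1`
  have hunit : ∀ i, i ∉ G → f i = 1 := by
    intro i hi
    have hlow : P i < 1 := by
      by_contra h; exact hi (Finset.mem_filter.2 ⟨Finset.mem_univ i, not_lt.1 h⟩)
    exact factorMain_eq_one i.isLt hU1 hΔ0.le (by linarith) hlow (hzero i)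
  have hhalf : ∀ i, i ∉ G → 1 ≤ (1 + Δ) * P i := by
    intro i hi
    obtain ⟨n, hn⟩ : ∃ n, f i n ≠ 0 := by
      by_contra h
      push Not at h
      exact hzero i (ArithmeticFunction.ext fun n => by rw [h n]; rfl)
    have hn0 : n ≠ 0 := by rintro rfl; exact hn (by simp [hf])
    obtain ⟨-, h2, -⟩ := factorMain_support hΔ' (κ i) hn
    have : (1 : ℝ) ≤ n := by exact_mod_cast Nat.one_le_iff_ne_zero.2 hn0
    exact this.trans h2
  -- `prodMain = ∏_G f`
  have hprodG : prodMain x z Δ U j κ = ∏ i ∈ G, f i := by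
    rw [hprod, ← Finset.prod_filter_mul_prod_filter_not Finset.univ (fun i => 1 ≤ P i) f]
    have : ∏ i ∈ Finset.univ.filter (fun i => ¬ 1 ≤ P i), f i = 1 :=
      Finset.prod_eq_one fun i hi => hunit i (fun hiG => (Finset.mem_filter.1 hi).2 (hPG i hiG))
    rw [this, mul_one]
  -- the three size conditions
  have htupleLow : tupleLow x Δ j κ = (∏ i ∈ G, P i) * ∏ i ∈ Finset.univ.filter (fun i => ¬ 1 ≤ P i), P i :=
    (Finset.prod_filter_mul_prod_filter_not Finset.univ (fun i => 1 ≤ P i) P).symm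
  have hNG1 : ∏ i ∈ Finset.univ.filter (fun i => ¬ 1 ≤ P i), P i ≤ 1 :=
    Finset.prod_le_one (fun i _ => (hP0 i).le) (fun i hi => (not_le.1 (Finset.mem_filter.1 hi).2).le)
  have hNGhalf : (1 / 2 : ℝ) ^ 14 ≤ ∏ i ∈ Finset.univ.filter (fun i => ¬ 1 ≤ P i), P i := by
    have hcard : (Finset.univ.filter (fun i : Fin (2 * j) => ¬ 1 ≤ P i)).card ≤ 14 :=
      (Finset.card_filter_le _ _).trans (by rw [Finset.card_univ, Fintype.card_fin]; omega)
    calc (1 / 2 : ℝ) ^ 14 ≤ (1 / 2) ^ (Finset.univ.filter (fun i : Fin (2 * j) => ¬ 1 ≤ P i)).card :=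
          pow_le_pow_of_le_one (by norm_num) (by norm_num) hcard
      _ = ∏ i ∈ Finset.univ.filter (fun i : Fin (2 * j) => ¬ 1 ≤ P i), (1 / 2 : ℝ) := (Finset.prod_const _).symm
      _ ≤ _ := by
          refine Finset.prod_le_prod (fun _ _ => by norm_num) fun i hi => ?_
          have hiG : i ∉ G := fun hiG => (Finset.mem_filter.1 hi).2 (hPG i hiG)
          have := hhalf i hiG
          nlinarith [hP0 i, hΔ2]
  have hGP0 : 0 ≤ ∏ i ∈ G, P i := Finset.prod_nonneg fun i _ => (hP0 i).le
  have hX1 : x ≤ ∏ i ∈ G, P i := by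
    have h := hInt.1
    rw [htupleLow] at h
    exact h.trans (mul_le_of_le_one_right hGP0 hNG1)
  have htupleHigh : tupleHigh x Δ j κ ≤ 2 * x := hInt.2
  have hX2 : (∏ i ∈ G, P i) ≤ 2 ^ 15 * x := by
    have hlow_le : tupleLow x Δ j κ ≤ 2 * x := by
      have h1 : tupleLow x Δ j κ ≤ tupleHigh x Δ j κ := by
        rw [tupleHigh_eq hΔ' κ]
        exact le_mul_of_one_le_left (tupleLow_pos hx0 hΔ' κ).le (one_le_pow₀ (by linarith))
      exact h1.trans htupleHigh
    rw [htupleLow] at hlow_le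
    have h2 : (∏ i ∈ G, P i) * (1 / 2 : ℝ) ^ 14 ≤ 2 * x :=
      (mul_le_mul_of_nonneg_left hNGhalf hGP0).trans hlow_le
    have h3 : (2 : ℝ) ^ 15 * x = (2 * x) / (1 / 2 : ℝ) ^ 14 := by norm_num; ring
    rw [h3, le_div_iff₀ (by norm_num)]
    exact h2
  have hX3 : (1 + Δ) ^ G.card * ∏ i ∈ G, P i ≤ 2 * x := by
    have h1 : tupleHigh x Δ j κ = ∏ i, (1 + Δ) * P i := by
      unfold tupleHigh
      exact Finset.prod_congr rfl fun i _ => boxHigh_eq_mul_boxLow hΔ' (κ i)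
    have h2 : ∏ i, (1 + Δ) * P i = (∏ i ∈ G, (1 + Δ) * P i) *
        ∏ i ∈ Finset.univ.filter (fun i => ¬ 1 ≤ P i), (1 + Δ) * P i :=
      (Finset.prod_filter_mul_prod_filter_not _ _ _).symm
    have h3 : ∏ i ∈ G, (1 + Δ) * P i = (1 + Δ) ^ G.card * ∏ i ∈ G, P i := by
      rw [Finset.prod_mul_distrib, Finset.prod_const]
    have h4 : 1 ≤ ∏ i ∈ Finset.univ.filter (fun i => ¬ 1 ≤ P i), (1 + Δ) * P i :=
      one_le_prod_pieces (P := fun i => (1 + Δ) * P i) (subset_refl _)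
        (fun i hi => hhalf i (fun hiG => (Finset.mem_filter.1 hi).2 (hPG i hiG)))
    have h5 : 0 ≤ ∏ i ∈ G, (1 + Δ) * P i := Finset.prod_nonneg fun i _ => by nlinarith [hP0 i, hΔ0]
    calc (1 + Δ) ^ G.card * ∏ i ∈ G, P i = ∏ i ∈ G, (1 + Δ) * P i := h3.symm
      _ ≤ (∏ i ∈ G, (1 + Δ) * P i) * ∏ i ∈ Finset.univ.filter (fun i => ¬ 1 ≤ P i), (1 + Δ) * P i :=
          le_mul_of_one_le_right h5 h4
      _ = tupleHigh x Δ j κ := by rw [← h2, ← h1]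
      _ ≤ 2 * x := htupleHigh
  have hG14 : G.card ≤ 14 :=
    (Finset.card_filter_le _ _).trans (by rw [Finset.card_univ, Fintype.card_fin]; omega)
  -- the types of the genuine pieces
  have htype : ∀ i ∈ G,
      (⇑(f i) = roughBoxOne z ⌊P i⌋₊ ⌊(1 + Δ) * P i⌋₊ ∧
        ∀ n : ℕ, n ≠ 0 → f i n = if P i < n ∧ (n : ℝ) ≤ (1 + Δ) * P i then
          (if IsRough z n then 1 else 0) else 0) ∨
      (P i < U ∧ ⇑(f i) = roughBoxMoebius z ⌊P i⌋₊ (min ⌊(1 + Δ) * P i⌋₊ U)) := by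
    intro i _
    by_cases hij : (i : ℕ) < j
    · right
      refine ⟨boxLow_lt_of_moebius_ne_zero hij (hzero i), ?_⟩
      have h := factorMain_coe_eq_roughBoxMoebius (z := z) (U := U) hij hx0 hΔ' (κ i)
      rw [boxHigh_eq_mul_boxLow hΔ' (κ i)] at h
      exact h
    · left
      have hji : j ≤ (i : ℕ) := not_lt.1 hij
      refine ⟨?_, fun n hn => ?_⟩
      · have h := factorMain_coe_eq_roughBoxOne (z := z) (U := U) hji i.isLt hx0 hΔ' (κ i)
        rw [boxHigh_eq_mul_boxLow hΔ' (κ i)] at h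
        exact h
      · have h := factorMain_apply_zeta (x := x) (z := z) (Δ := Δ) (U := U) hji i.isLt (κ i) hn
        rw [boxHigh_eq_mul_boxLow hΔ' (κ i)] at h
        exact h
  -- conclude
  have hsd : ∀ d : ℕ, sievedDisc (fun n => prodMain x z Δ U j κ n) d a z x =
      sievedDisc (fun n => (∏ i ∈ G, f i) n) d a z x := fun d => by rw [hprodG]
  rw [Finset.sum_congr rfl fun r _ => by
    rw [Finset.sum_congr rfl fun q _ => by rw [hsd (q * r)]]]
  exact hmain x hx₀ G f P Δ U Q R δ hδ hQ1 hR1 hRx hQR hΔ0 hΔ2 hΔ14 hG14 hU hPG hf1 hsupp hneG htype hX1 hX2 hX3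


end BFI

end Literature.NumberTheory.Sieve
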